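import Mathlib
import Summits.KontsevichZagierPeriods.Zeta5Search.RVLargeParamMidPoles
import HarnessLib

/-!
# RVLargeParamMidCases — the three configuration theorems of the mid band (fam-rv gen 10, file 2; #10.2)

HONEST FRAMING: systematic search; no irrationality claim unless certified.  In the SETTING of file 10.1 (`c` in the polytope,
slot `i` least, other blocks short, `N = N_p(c)`), with at least one `p`-LARGE lower parameter (`nbig ≥ 1`):

* (A) `palCase_neg_six`: `N ≤ 9 ⇒ palCase c p (−6)`.  A class with `E_x = −6` consists of a sextic pole `q` flanked by two
  positions of net exponent `0` — type `(0, −6, 0)`, palindromic and centre-free (`class_of_classExp_eq_neg_six`).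
* (B') `countingCase_neg_four_of_partner`: `N ≤ 5` and an LP partner `k ≠ i` (`c_k ≥ p`, `c₀ − c_i − c_k ≥ p`) ⇒ every pole
  class has `ν_x ≥ −4` (a deficient quintic pole would hand out six unit pair floors).
* (B) `zLayerCase_neg_four`: `N ≤ 6`, `2p ≤ d + 1` and (`N ≤ 5` or `nbig ≥ 2`) ⇒ the zero-layer test passes at `−4`
  (clause (D) = `deficient_pole_level`; clause (C) via zero partners / level-zero partners; (M1) when two blocks are large,
  (M2) = `lzd_mirror_of_inQ` when `N ≤ 5`).
These are exactly the cases met by `b` and `b + e_j` in the band `−5 ≤ −N_p(b) + lpBonus ≤ −4` (file 10.3).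
Integer bookkeeping only; nothing about irrationality.
-/

noncomputable section

open Finset

namespace Summit.KontsevichZagierPeriods.Zeta5Search.ClusterValuation

open Summit.KontsevichZagierPeriods.Zeta5Search.DualSeries (InBox)
open Summit.KontsevichZagierPeriods.Zeta5Search.WedgeDictionary (dOf)
open Summit.KontsevichZagierPeriods.Zeta5Search.CasoratianValuation (InPolytope pairFloors)
open Summit.KontsevichZagierPeriods.Zeta5Search.RVFlatGauge (countingCase palType palCase)
open Summit.KontsevichZagierPeriods.Zeta5Search.RVFlatGauge.Cap (nbig)

variable {p : ℕ}

/-! ### (A) The palindromic case at `−6` -/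

/-- Reflection of block membership: `c₀ − s ∈ B_j ↔ s ∈ B_j` (`s ≤ c₀`, `2c_j ≤ c₀`). -/
theorem mem_blk_reflect (c : ℕ → ℤ) (hc : InPolytope c) {j : ℕ} (hj : j ∈ range 7) {s : ℕ} (hs : s ≤ (c 0).toNat) :
    (c 0).toNat - s ∈ blk c j ↔ s ∈ blk c j := by
  rw [mem_blk, mem_blk]
  have h0 : 0 ≤ c 0 := hc.1.1
  have hβ : 0 ≤ c (j + 1) := (hc.1.2 j hj).1
  have h2 : 2 * c (j + 1) ≤ c 0 := hc.2.1 j hj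
  have e0 : (((c 0).toNat : ℕ) : ℤ) = c 0 := Int.toNat_of_nonneg h0
  have ej : (((c (j + 1)).toNat : ℕ) : ℤ) = c (j + 1) := Int.toNat_of_nonneg hβ
  omega

/-- **ANATOMY OF A CLASS WITH `E_x = −6`** (`nbig ≥ 1`, `N ≤ 9`): a single sextic pole `q` off the centre with
`p ≤ q < 2p`, `q + p ≤ c₀ < q + 2p`, every other class point of net exponent `0`. -/
theorem class_of_classExp_eq_neg_six (c : ℕ → ℤ) (hc : InPolytope c) (hp : 0 < p) {i : ℕ} (hi : i ∈ range 7)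
    (hmin : ∀ k ∈ range 7, c (i + 1) ≤ c (k + 1)) (hshort : ∀ k ∈ (range 7).erase i, c 0 - 2 * c (k + 1) < p)
    (hn1 : 1 ≤ nbig c p) (hN : pairFloors c p ≤ 9) {x : ℕ} (hE : classExp c p x = -6) :
    classPoleCount c p x = 1 ∧ ∃ q ∈ classSet c p x, netExp c q = -6 ∧ 2 * (q : ℤ) ≠ c 0 ∧ p ≤ q ∧ q < 2 * p ∧
      q + p ≤ (c 0).toNat ∧ (c 0).toNat < q + 2 * p ∧ ∀ s ∈ classSet c p x, s ≠ q → netExp c s = 0 := by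
  have hbox : InBox c := hc.1
  have h0 : 0 ≤ c 0 := hbox.1
  have e0 : (((c 0).toNat : ℕ) : ℤ) = c 0 := Int.toNat_of_nonneg h0
  have hβi0 : 0 ≤ c (i + 1) := (hbox.2 i hi).1
  have ei : (((c (i + 1)).toNat : ℕ) : ℤ) = c (i + 1) := Int.toNat_of_nonneg hβi0
  have hpole := one_le_classPoleCount_of_classExp_neg c (x := x) (by rw [hE]; norm_num)
  have h1 : classPoleCount c p x = 1 := le_antisymm (classPoleCount_le_one_of_short_blocks c hc hp hshort x) hpole
  obtain ⟨q, hq⟩ := card_pos.1 (by unfold classPoleCount at hpole; omega :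
    0 < ((classSet c p x).filter fun s => netExp c s < 0).card)
  rw [mem_filter] at hq
  have hEq := classExp_ge_pole c h1 hq.1 hq.2
  have h6' := netExp_ge_neg_six c q
  have h6 : netExp c q = -6 := by linarith
  have hbc : blockCount c q = 7 ∧ 2 * (q : ℤ) ≠ c 0 := by
    have h7 := blockCount_le c q
    unfold netExp at h6
    split_ifs at h6 with h2
    · exfalso; omega
    · exact ⟨by omega, h2⟩
  obtain ⟨hothers, -⟩ := netExp_eq_zero_of_classExp_le c h1 hq.1 hq.2 (by rw [hE, h6])
  have hqn : q ≤ (c 0).toNat := le_of_mem_classSet c hq.1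
  -- a large block contains `q`: `p ≤ q ≤ c₀ − p`
  obtain ⟨a, ha, hβa⟩ := exists_big_of_nbig c hn1
  have ea : (((c (a + 1)).toNat : ℕ) : ℤ) = c (a + 1) := Int.toNat_of_nonneg (by linarith)
  have hqa := (mem_blk c a q).1 (mem_blk_of_blockCount_eq_seven c hbc.1 ha)
  have hpq : p ≤ q := by omega
  have hqpn : q + p ≤ (c 0).toNat := by omega
  have hqi : q ∈ blk c i := mem_blk_of_blockCount_eq_seven c hbc.1 hi
  -- the neighbours `q ∓ p` have net exponent `0`, hence lie in `B_i`
  have hdn : q - p ∈ classSet c p x := sub_mem_classSet c hq.1 hpq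
  have hup : q + p ∈ classSet c p x := add_mem_classSet c hq.1 hqpn
  have hdn0 := hothers _ hdn (by omega)
  have hup0 := hothers _ hup (by omega)
  have hdni := ((mem_blk c i (q - p)).1 (mem_blk_of_netExp_le_zero c hbox hi hmin hdn0.le)).1
  have hupi := ((mem_blk c i (q + p)).1 (mem_blk_of_netExp_le_zero c hbox hi hmin hup0.le)).2
  -- `q < c_i + 2p` (units), hence `q < 2p`
  have hfar : (q : ℤ) < c (i + 1) + 2 * p := by
    by_contra h
    push Not at h
    have hu := mul_depth_le_pairFloors c hc hp hi (m := 2) hqi (by push_cast; linarith)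
    rw [hbc.1] at hu; push_cast at hu; linarith
  have hq2 : q < 2 * p := by
    by_contra h
    push Not at h
    have hdd : q - p - p ∈ classSet c p x := sub_mem_classSet c hdn (by omega)
    have hdd0 := hothers _ hdd (by omega)
    have := ((mem_blk c i (q - p - p)).1 (mem_blk_of_netExp_le_zero c hbox hi hmin hdd0.le)).1
    omega
  -- the mirror `c₀ − q` is a depth-7 position of `B_i`: `c₀ − q < c_i + 2p`, hence `c₀ < q + 2p`
  have hmi : (c 0).toNat - q ∈ blk c i := (mem_blk_reflect c hc hi hqn).2 hqi
  have hmfar : (((c 0).toNat - q : ℕ) : ℤ) < c (i + 1) + 2 * p := by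
    by_contra h
    push Not at h
    have hu := mul_depth_le_pairFloors c hc hp hi (m := 2) hmi (by push_cast; linarith)
    rw [blockCount_reflect c hqn, hbc.1] at hu; push_cast at hu; linarith
  have hn2 : (c 0).toNat < q + 2 * p := by
    by_contra h
    push Not at h
    have huu : q + p + p ∈ classSet c p x := add_mem_classSet c hup (by omega)
    have huu0 := hothers _ huu (by omega)
    have := ((mem_blk c i (q + p + p)).1 (mem_blk_of_netExp_le_zero c hbox hi hmin huu0.le)).2
    push_cast [Nat.cast_sub hqn] at hmfar
    omega
  exact ⟨h1, q, hq.1, h6, hbc.2, hpq, hq2, hqpn, hn2, hothers⟩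

/-- **(A) THE PALINDROMIC CASE AT `−6`:** `nbig ≥ 1` and `N ≤ 9` give `palCase c p (−6)`. -/
theorem palCase_neg_six (c : ℕ → ℤ) (hc : InPolytope c) (hp : 0 < p) {i : ℕ} (hi : i ∈ range 7)
    (hmin : ∀ k ∈ range 7, c (i + 1) ≤ c (k + 1)) (hshort : ∀ k ∈ (range 7).erase i, c 0 - 2 * c (k + 1) < p)
    (hn1 : 1 ≤ nbig c p) (hN : pairFloors c p ≤ 9) : palCase c p (-6) = true := by
  have hbox : InBox c := hc.1
  have h0 : 0 ≤ c 0 := hbox.1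
  have e0 : (((c 0).toNat : ℕ) : ℤ) = c 0 := Int.toNat_of_nonneg h0
  obtain ⟨a, ha, hβa⟩ := exists_big_of_nbig c hn1
  have h2a : 2 * c (a + 1) ≤ c 0 := hc.2.1 a ha
  have hpn : p ≤ (c 0).toNat := by omega
  have hA : ∀ x ∈ range p, -6 ≤ classExp c p x := fun x _ =>
    classExp_ge_neg_six c x (classPoleCount_le_one_of_short_blocks c hc hp hshort x)
  have hB : ∀ x ∈ range p, classExp c p x = -6 → ¬ CentreIn c p x := by
    intro x hx hE hcen
    have hxp := mem_range.1 hx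
    obtain ⟨h1, q, hq, h6, h2q, -, -, -, -, -⟩ := class_of_classExp_eq_neg_six c hc hp hi hmin hshort hn1 hN hE
    have hqn : q ≤ (c 0).toNat := le_of_mem_classSet c hq
    have hxx : x ∈ classSet c p x := mem_filter.2 ⟨mem_range.2 (by omega), rfl⟩
    have hdvd : (p : ℤ) ∣ (q : ℤ) - (((c 0).toNat - q : ℕ) : ℤ) := by
      have h := (dvd_sub_of_mem_classSet c hq hxx).mul_left 2
      have e : (q : ℤ) - (((c 0).toNat - q : ℕ) : ℤ) = 2 * ((q : ℤ) - x) + (2 * (x : ℤ) - c 0) := by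
        push_cast [Nat.cast_sub hqn]; omega
      rw [e]; exact dvd_add h hcen
    have hmod : q % p = ((c 0).toNat - q) % p := Nat.modEq_iff_dvd.2 (by
      have := hdvd; rwa [← neg_sub, dvd_neg] at this)
    have hmem : (c 0).toNat - q ∈ classSet c p x :=
      mem_filter.2 ⟨mem_range.2 (by omega), hmod.symm.trans (mem_filter.1 hq).2⟩
    have hneg : netExp c ((c 0).toNat - q) < 0 := by rw [netExp_reflect c h0 hqn]; omega
    have := eq_pole_of_count_one c h1 hq (by omega) hmem hneg
    omega
  have hC : ∀ x ∈ range p, classExp c p x = -6 → palType c p x = true := by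
    intro x hx hE
    have hxp := mem_range.1 hx
    obtain ⟨h1, q, hq, h6, -, hpq, hq2, hqpn, hn2, hothers⟩ :=
      class_of_classExp_eq_neg_six c hc hp hi hmin hshort hn1 hN hE
    have hqx : q % p = x := by rw [(mem_filter.1 hq).2]; exact Nat.mod_eq_of_lt hxp
    have hx : x = q - p := by
      have e : (q - p + p) % p = (q - p) % p := Nat.add_mod_right _ _
      rw [Nat.sub_add_cancel hpq, hqx] at e
      rw [e]; exact Nat.mod_eq_of_lt (by omega)
    have hdn0 := hothers _ (sub_mem_classSet c hq hpq) (by omega)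
    have hup0 := hothers _ (add_mem_classSet c hq hqpn) (by omega)
    have hL : ((c 0).toNat - x) / p = 2 := Nat.div_eq_of_lt_le (by omega) (by omega)
    unfold palType
    rw [hL]
    simp only [List.all_eq_true, List.mem_range, beq_iff_eq]
    intro k hk
    interval_cases k
    · rw [show x + (2 - 0) * p = q + p by omega, show x + 0 * p = q - p by omega, hup0, hdn0]
    · rfl
    · rw [show x + (2 - 2) * p = q - p by omega, show x + 2 * p = q + p by omega, hup0, hdn0]
  simp only [palCase, Bool.and_eq_true, decide_eq_true_eq]
  exact ⟨⟨⟨⟨⟨hpn, by norm_num⟩, by norm_num⟩, hA⟩, hB⟩, hC⟩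

/-! ### (B') The counting case with an LP partner -/

/-- **(B') COUNTING AT `−4` FROM AN LP PARTNER:** `N ≤ 5`, `k ≠ i` with `c_k ≥ p` and `c₀ − c_i − c_k ≥ p` ⇒ every pole class
has `ν_x ≥ −4`. -/
theorem countingCase_neg_four_of_partner (c : ℕ → ℤ) (hc : InPolytope c) (hp : 0 < p) {i : ℕ} (hi : i ∈ range 7)
    (hmin : ∀ k ∈ range 7, c (i + 1) ≤ c (k + 1)) (hshort : ∀ k ∈ (range 7).erase i, c 0 - 2 * c (k + 1) < p)
    (hN5 : pairFloors c p ≤ 5) {k : ℕ} (hk : k ∈ (range 7).erase i) (hβk : (p : ℤ) ≤ c (k + 1))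
    (hAk : (p : ℤ) ≤ c 0 - c (i + 1) - c (k + 1)) : countingCase c p (-4) = true := by
  have hbox : InBox c := hc.1
  have h0 : 0 ≤ c 0 := hbox.1
  have e0 : (((c 0).toNat : ℕ) : ℤ) = c 0 := Int.toNat_of_nonneg h0
  have hβi0 : 0 ≤ c (i + 1) := (hbox.2 i hi).1
  have ei : (((c (i + 1)).toNat : ℕ) : ℤ) = c (i + 1) := Int.toNat_of_nonneg hβi0
  have ek : (((c (k + 1)).toNat : ℕ) : ℤ) = c (k + 1) := Int.toNat_of_nonneg (by linarith)
  unfold countingCase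
  refine decide_eq_true fun x hx hpole => ?_
  by_contra hlt
  push Not at hlt
  obtain ⟨h1, hνE, q, hq, hqp, -, hwild⟩ := wild_of_classNu_neg c hc hp hi hmin hshort hpole (by linarith)
  have hE : classExp c p x ≤ -5 := by linarith
  have hEq := classExp_ge_pole c h1 hq hqp
  have hqi : q ∈ blk c i := mem_blk_of_netExp_le_zero c hbox hi hmin hqp.le
  have hqn : q ≤ (c 0).toNat := le_of_mem_classSet c hq
  obtain ⟨hunit, hcount⟩ := short_star c hc hi (p := p) (m := 1) hqi (by push_cast; linarith)
  have h6 : 6 ≤ blockCount c q := six_le_blockCount_of_le c (by linarith)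
  have hbc : blockCount c q = 6 := by
    have hu := mul_depth_le_pairFloors c hc hp hi (m := 1) hqi (by push_cast; linarith)
    push_cast at hu; omega
  have hq5 : -5 ≤ netExp c q := by unfold netExp; rw [hbc]; split_ifs <;> norm_num
  obtain ⟨hothers, -⟩ := netExp_eq_zero_of_classExp_le c h1 hq hqp (by linarith)
  -- the partner block `B_k` contains `q` (else six units), so `q + p ≤ c₀`
  have hqk : q ∈ blk c k := by
    by_contra hqk
    set T := ((range 7).erase i).filter (fun j => q ∈ blk c j) with hT
    have hkT : k ∉ T := fun h => hqk (mem_filter.1 h).2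
    have hS : insert k T ⊆ (range 7).erase i := insert_subset hk (filter_subset _ _)
    have hu : ∀ j ∈ insert k T, (p : ℤ) ≤ c 0 - c (i + 1) - c (j + 1) := by
      intro j hj
      rcases mem_insert.1 hj with rfl | hj
      · exact hAk
      · have := hunit j hj; push_cast at this; linarith
    have h := card_le_pairFloors_of_units c hc hp hi hS hu
    rw [card_insert_of_notMem hkT] at h
    push_cast at h hcount
    have : (6 : ℤ) ≤ blockCount c q := by exact_mod_cast h6
    linarith
  have hqtop := ((mem_blk c k q).1 hqk).2
  have hup : q + p ∈ classSet c p x := add_mem_classSet c hq (by omega)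
  have hup0 := hothers _ hup (by omega)
  have hupi := ((mem_blk c i (q + p)).1 (mem_blk_of_netExp_le_zero c hbox hi hmin hup0.le)).2
  have h6N := six_le_pairFloors_of_long2 c hc hp hi (by omega)
  omega

/-! ### (B) The zero-layer case at `−4` -/

/-- **(B) THE ZERO-LAYER CASE AT `−4`:** `nbig ≥ 1`, `N ≤ 6`, `2p ≤ d + 1` and (`N ≤ 5` or `nbig ≥ 2`) give
`zLayerCase c p (−4)`. -/
theorem zLayerCase_neg_four (c : ℕ → ℤ) (hc : InPolytope c) (hp : 0 < p) {i : ℕ} (hi : i ∈ range 7)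
    (hmin : ∀ k ∈ range 7, c (i + 1) ≤ c (k + 1)) (hshort : ∀ k ∈ (range 7).erase i, c 0 - 2 * c (k + 1) < p)
    (hn1 : 1 ≤ nbig c p) (hN6 : pairFloors c p ≤ 6) (hd : 2 * (p : ℤ) ≤ dOf c + 1)
    (hM : pairFloors c p ≤ 5 ∨ 2 ≤ nbig c p) : zLayerCase c p (-4) = true := by
  have hbox : InBox c := hc.1
  have h0 : 0 ≤ c 0 := hbox.1
  have e0 : (((c 0).toNat : ℕ) : ℤ) = c 0 := Int.toNat_of_nonneg h0
  have hβi0 : 0 ≤ c (i + 1) := (hbox.2 i hi).1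
  have ei : (((c (i + 1)).toNat : ℕ) : ℤ) = c (i + 1) := Int.toNat_of_nonneg hβi0
  have hle1 := classPoleCount_le_one_of_short_blocks c hc hp hshort
  obtain ⟨a, ha, hβa⟩ := exists_big_of_nbig c hn1
  have h2a : 2 * c (a + 1) ≤ c 0 := hc.2.1 a ha
  have ea : (((c (a + 1)).toNat : ℕ) : ℤ) = c (a + 1) := Int.toNat_of_nonneg (by linarith)
  -- (D): deficient classes
  have hD : ∀ x ∈ range p, defClass c p x = true → classPoleCount c p x = 1 ∧
      ∀ s ∈ classSet c p x, netExp c s < 0 → p ≤ s ∧ s < 3 * p ∧ (2 * p ≤ s → 0 < netExp c (s - 2 * p)) := by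
    intro x hx hdef
    obtain ⟨hpole, hν⟩ := (defClass_iff c p x).1 hdef
    obtain ⟨h1, hνE, q, hq, hqp, hpq, hwild⟩ := wild_of_classNu_neg c hc hp hi hmin hshort hpole (by linarith)
    refine ⟨h1, fun s hs hsneg => ?_⟩
    obtain rfl := eq_pole_of_count_one c h1 hq hqp hs hsneg
    obtain ⟨-, h3, hz⟩ := deficient_pole_level c hc hp hi hmin (by omega) h1 hq hqp hwild (by linarith)
    exact ⟨hpq, h3, hz⟩
  -- (C): poles of order `≥ 5` outside the deficient classes
  have hC : ∀ x ∈ range p, ∀ s ∈ classSet c p x, netExp c s ≤ -5 → defClass c p x = false →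
      (p ≤ s ∧ classPoleCount c p x = 1 ∧ 0 < netExp c (s - p)) ∨ -4 ≤ classExp c p x ∨ lzd c p s = true := by
    intro x hx s hs hs5 hndef
    by_cases hE4 : -4 ≤ classExp c p x
    · exact Or.inr (Or.inl hE4)
    push Not at hE4
    have h1 : classPoleCount c p x = 1 :=
      le_antisymm (hle1 x) (by unfold classPoleCount; exact card_pos.2 ⟨s, mem_filter.2 ⟨hs, by omega⟩⟩)
    have hν : -4 ≤ classNu c p x := by
      by_contra hν
      push Not at hν
      rw [(defClass_iff c p x).2 ⟨by omega, hν⟩] at hndef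
      exact Bool.noConfusion hndef
    have htame : classPoleCount c p x = 1 ∧ tameSingle c p x = true := by
      by_contra ht
      unfold classNu at hν; rw [if_neg ht] at hν; linarith
    obtain ⟨q, hq, hqneg, hor⟩ := of_decide_eq_true (by unfold tameSingle at htame; exact htame.2)
    obtain rfl := eq_pole_of_count_one c h1 hs (by omega) hq hqneg
    rcases hor with hlt | hall
    · -- a tame pole below `p`: a level-zero partner
      right; right
      have hq5 : netExp c q = -5 := by
        have h6 := netExp_ge_neg_six c q
        rcases (show netExp c q = -5 ∨ netExp c q = -6 by omega) with h | h
        · exact h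
        · exfalso
          have hbc : blockCount c q = 7 := by
            have h7 := blockCount_le c q
            unfold netExp at h; split_ifs at h <;> omega
          have := ((mem_blk c a q).1 (mem_blk_of_blockCount_eq_seven c hbc ha)).1
          omega
      exact lzd_of_level_zero c hc hp hi hmin hshort (by linarith) hlt hq5 (by rw [classExp_eq_of_mem hq]; linarith)
    · by_cases hpq : p ≤ q
      · exact Or.inl ⟨hpq, h1, hall _ (sub_mem_classSet c hq hpq) (by omega)⟩
      · right; right
        push Not at hpq
        have hq5 : netExp c q = -5 := by
          have h6 := netExp_ge_neg_six c q
          rcases (show netExp c q = -5 ∨ netExp c q = -6 by omega) with h | h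
          · exact h
          · exfalso
            have hbc : blockCount c q = 7 := by
              have h7 := blockCount_le c q
              unfold netExp at h; split_ifs at h <;> omega
            have := ((mem_blk c a q).1 (mem_blk_of_blockCount_eq_seven c hbc ha)).1
            omega
        exact lzd_of_level_zero c hc hp hi hmin hshort (by linarith) hpq hq5 (by rw [classExp_eq_of_mem hq]; linarith)
  -- (M): (M2) under `N ≤ 5`, (M1) under two large blocks
  have hMM : (∀ x ∈ range p, ∀ s ∈ classSet c p x, lzd c p s = false) ∨
      (∀ x ∈ range p, ∀ s ∈ classSet c p x, inQ c p s = true →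
        netExp c s = -5 ∧ lzd c p ((c 0).toNat - s) = true) := by
    rcases hM with hN5 | hn2
    · exact Or.inr fun x _ s hs hQ => lzd_mirror_of_inQ c hc hp hi hmin hshort hN5 (le_of_mem_classSet c hs) hQ
    · refine Or.inl fun x _ s _ => ?_
      obtain ⟨a₁, ha₁, a₂, ha₂, hne, hβ₁, hβ₂⟩ := exists_two_big_of_nbig c hn2
      have e₁ : (((c (a₁ + 1)).toNat : ℕ) : ℤ) = c (a₁ + 1) := Int.toNat_of_nonneg (by linarith)
      have e₂ : (((c (a₂ + 1)).toNat : ℕ) : ℤ) = c (a₂ + 1) := Int.toNat_of_nonneg (by linarith)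
      cases h : lzd c p s
      · rfl
      · exfalso
        obtain ⟨hsp, h5, -, -⟩ := (lzd_iff c p s).1 h
        rcases mem_or_mem_of_six_le c (six_le_blockCount_of_le c h5.le) ha₁ ha₂ hne with hm | hm
        · have := ((mem_blk c a₁ s).1 hm).1; omega
        · have := ((mem_blk c a₂ s).1 hm).1; omega
  simp only [zLayerCase, Bool.and_eq_true, Bool.or_eq_true, decide_eq_true_eq]
  exact ⟨⟨⟨⟨⟨by norm_num, by linarith⟩, fun x _ h2 => absurd h2 (by have := hle1 x; omega)⟩, hD⟩, hC⟩, hMM⟩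

end Summit.KontsevichZagierPeriods.Zeta5Search.ClusterValuation

end
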